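import Summits.CriticalPhenomena.PercolationContinuityZ3.Theorems.PercShatteringRaceNearLinearTwoClusterDecayOfSparseShellNonCertainty
import Summits.CriticalPhenomena.PercolationContinuityZ3.Theorems.PercShatteringRaceNearLinearTwoClusterDecayShellRestriction
import Summits.CriticalPhenomena.PercolationContinuityZ3.Theorems.PercShatteringRaceNearLinearTwoClusterDecayStubShellEncoding
import Literature.Probability.Percolation.SharpnessDCTProofs

/-!
# Route `PercShatteringRace` — posited objects of the crux lines for `NearLinearTwoClusterDecay` (stmt-CriticalPhenomena-5785)

Definitions file (D-0016: objects a route/line posits live in `Theorems/<RouteSlug>Defs.lean`, reviewed).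
This first instalment is the COUNTING VOCABULARY of the line `shell-product-kiss-positivity` (idea cards
`Cruxes/NearLinearTwoClusterDecay/Ideas/shell-product-kiss-positivity.md` and `…/single-edge-doors-flux-balance.md`,
lead skeleton `Cruxes/NearLinearTwoClusterDecay/Lines/shell_product_kiss_positivity.lean`, seat c1): the closed shell
`S(r,R) = {r ≤ ‖v‖∞ ≤ R}` of `ℤ³` with its FREE bond configuration, its crossing points and crossing clusters, the level
sets `{N(r,R) ≥ k}` / `{N(r,R) = k}` of the number `N` of distinct shell-crossing clusters, kisses and kiss edges
(closed lattice bonds between two distinct crossing clusters), the fibre weight of the single-edge "door" surgery, and the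
three per-shell atoms the line leaves open at `p_c(ℤ³)` — `GoodAt M k` (`P(N(r,Mr) ≥ k) ≤ 1 - c`; `GoodAt M 2` is the
bounded-aspect non-proliferation `NP_M`, `GoodAt M (k₀+1)` is tightness `Tight_M(k₀)`), `KissPosAt M k` (kiss positivity
at level `k`) and `BoundedFibreAt M k` (bounded second moment of the fibre weight).  Everything is a transparent `def` over
tree declarations (`box`, `innerBoundary`, `zdGraph`, `openConnIn`, `bondPercolation`, `criticalProbI`); no new notion of
percolation theory is introduced.  API landed with the definitions: `nearLinearTwoClusterDecay_of_goodAt` / `critBoxTwoArmsDecay_of_goodAt`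
(`∃ M ≥ 2, GoodAt M 2` ⇒ the crux, resp. stmt-0859, through the landed open-shell chain — the aspect doubles).
Consumers: `Theorems/PercShatteringRaceNearLinearTwoClusterDecayOfTightKiss*.lean` (the certified composition
`Tight ∧ KissPos ∧ BoundedFibre ⇒ GoodAt M 2`).

References: G. Grimmett, *Percolation* (2nd ed. 1999) §1.3 (configurations restricted to a vertex set), §2.4 (finite
energy / single-edge modification); M. Aizenman, *On the number of incipient spanning clusters*, Nucl. Phys. B 485 (1997)
(the spanning-cluster number); J. van den Berg, D. van Engelenburg, arXiv:2009.13337 §2 (two-arm events of annuli in `ℤ^d`).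
-/

noncomputable section

namespace Summit.CriticalPhenomena.PercolationContinuityZ3.Theorems.NearLinearTwoClusterDecayKiss

open MeasureTheory
open Literature.Probability.LatticeModels Literature.Probability.Percolation

/-- The CLOSED SHELL `S(r,R) = {r ≤ ‖v‖∞ ≤ R} = Λ(R) ∖ (Λ(r) ∖ ∂ⁱⁿΛ(r))` of `ℤ³`, as a set of sites
(`Λ(n) = box 3 n`, `∂ⁱⁿ` = `innerBoundary (zdGraph 3)`). Connections "inside the shell" are `openConnIn (shell r R)`
(free boundary condition: only bonds with both endpoints in the shell are used). -/
def shell (r R : ℕ) : Set (Site 3) :=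
  (↑(box 3 R) : Set (Site 3)) \ ((↑(box 3 r) : Set (Site 3)) \ ↑(innerBoundary (zdGraph 3) (box 3 r)))

/-- The closed shell as a `Finset` of sites (`↑(shellF r R) = shell r R`). -/
def shellF (r R : ℕ) : Finset (Site 3) :=
  box 3 R \ (box 3 r \ innerBoundary (zdGraph 3) (box 3 r))

/-- All unordered PAIRS of shell sites: a finite set of pairs containing every lattice bond of the shell; every
counting event below is determined by the states of these pairs. -/
def shellPairs (r R : ℕ) : Finset (Sym2 (Site 3)) := (shellF r R).sym2

/-- The CROSSING POINTS of the shell `S(r,R)` in `ω`: the sites of the inner sphere `∂ⁱⁿΛ(r)` joined inside the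
shell to a site of the outer sphere `∂ⁱⁿΛ(R)`. -/
def crossPts (r R : ℕ) (ω : BondConfig (Site 3)) : Set (Site 3) :=
  {x | x ∈ innerBoundary (zdGraph 3) (box 3 r) ∧
    ∃ y ∈ innerBoundary (zdGraph 3) (box 3 R), ω ∈ openConnIn (shell r R) x y}

/-- `{N(r,R) ≥ k}`: there are `k` pairwise shell-disconnected crossing points, i.e. the free shell configuration has
at least `k` distinct open clusters meeting both spheres (Aizenman's spanning-cluster number of the shell is `≥ k`). -/
def AtLeast (r R k : ℕ) : Set (BondConfig (Site 3)) :=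
  {ω | ∃ x : Fin k → Site 3, (∀ i, x i ∈ crossPts r R ω) ∧
      ∀ i j, i ≠ j → ω ∉ openConnIn (shell r R) (x i) (x j)}

/-- `{N(r,R) = k}`: at least `k` but not `k + 1` distinct shell-crossing clusters. -/
def Level (r R k : ℕ) : Set (BondConfig (Site 3)) := AtLeast r R k \ AtLeast r R (k + 1)

/-- The BODY of the crossing clusters: the sites joined inside the shell both to the inner and to the outer sphere
(= the union of the vertex sets of the crossing clusters). -/
def crossBody (r R : ℕ) (ω : BondConfig (Site 3)) : Set (Site 3) :=
  {u | ∃ x ∈ innerBoundary (zdGraph 3) (box 3 r), ∃ y ∈ innerBoundary (zdGraph 3) (box 3 R),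
    ω ∈ openConnIn (shell r R) x u ∧ ω ∈ openConnIn (shell r R) u y}

/-- A KISS of the shell configuration: two lattice-ADJACENT sites `u ~ v` lying on two DISTINCT crossing clusters
(each on the crossing body, not joined to each other inside the shell; the bond `uv` is then closed). -/
def Kiss (r R : ℕ) : Set (BondConfig (Site 3)) :=
  {ω | ∃ u v : Site 3, (zdGraph 3).Adj u v ∧ u ∈ crossBody r R ω ∧ v ∈ crossBody r R ω ∧
      ω ∉ openConnIn (shell r R) u v}

open Classical in
/-- The KISS EDGES (the "doors" of the single-edge surgery) of `ω`: the lattice bonds of the shell whose two endpoints lie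
on two distinct crossing clusters; `(kissEdges r R ω).card` is the kiss count `K(ω)`. -/
def kissEdges (r R : ℕ) (ω : BondConfig (Site 3)) : Finset (Sym2 (Site 3)) :=
  (shellPairs r R).filter fun e => e ∈ (zdGraph 3).edgeSet ∧
    ∃ u v : Site 3, e = s(u, v) ∧ u ∈ crossBody r R ω ∧ v ∈ crossBody r R ω ∧
      ω ∉ openConnIn (shell r R) u v

/-- The FIBRE WEIGHT at level `k` of a configuration `ω'` (meant on `{N = k-1}`), the multiplicity weight of the
single-edge door surgery `(ω, e) ↦ (ω ∪ e, e)`: `F_k(ω') = Σ_b 1{b ∈ ω', ω' ∖ b ∈ {N = k}, b ∈ kissEdges(ω' ∖ b)} / K(ω' ∖ b)`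
— every splitting bridge `b` weighted by the reciprocal kiss count of the level-`k` configuration it comes from. -/
def fibre (r R k : ℕ) (ω : BondConfig (Site 3)) : ℝ :=
  ∑ b ∈ shellPairs r R,
    Set.indicator {ω' : BondConfig (Site 3) | b ∈ ω' ∧ ω' \ {b} ∈ Level r R k ∧ b ∈ kissEdges r R (ω' \ {b})}
      (fun ω' => (1 : ℝ) / ((kissEdges r R (ω' \ {b})).card : ℝ)) ω

/-- **`GoodAt M k`** — at the bounded aspect `M`, the shell `S(r, Mr)` carries `k` distinct crossing clusters with
probability at most `1 - c`, uniformly in large `r`, at `p_c(ℤ³)` (bond).  `GoodAt M 2` is the bounded-aspect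
NON-PROLIFERATION `NP_M` (the per-shell input of the landed orange-peeling chain); `GoodAt M (k₀ + 1)` is TIGHTNESS of
the crossing number in its weakest, positive-probability form (`P(N(r,Mr) ≤ k₀) ≥ c`; open in `d = 3`, false for `d ≥ 7`). -/
def GoodAt (M k : ℕ) : Prop :=
  ∃ c : ℝ, 0 < c ∧ ∃ r₀ : ℕ, ∀ r : ℕ, r₀ ≤ r →
    (bondPercolation (zdGraph 3) (criticalProbI 3)).real (AtLeast r (M * r) k) ≤ 1 - c

/-- **`KissPosAt M k`** — KISS POSITIVITY at level `k` and aspect `M` (open per-shell atom): on `{N(r,Mr) = k}` two of the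
crossing clusters are lattice-adjacent somewhere with conditional probability bounded below, uniformly in large `r`. -/
def KissPosAt (M k : ℕ) : Prop :=
  ∃ c : ℝ, 0 < c ∧ ∃ r₁ : ℕ, ∀ r : ℕ, r₁ ≤ r →
    c * (bondPercolation (zdGraph 3) (criticalProbI 3)).real (Level r (M * r) k) ≤
      (bondPercolation (zdGraph 3) (criticalProbI 3)).real (Level r (M * r) k ∩ Kiss r (M * r))

/-- **`BoundedFibreAt M k`** — BOUNDED FIBRE at level `k` and aspect `M` (open per-shell shape atom): the second moment
of the fibre weight on `{N(r,Mr) = k-1}` is controlled by its first moment, `E[F_k² ; N = k-1] ≤ C · E[F_k ; N = k-1]`,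
uniformly in large `r` (by the single-edge flux identity this is `E[door-averaged fibre | N = k, Kiss] = O(1)`). -/
def BoundedFibreAt (M k : ℕ) : Prop :=
  ∃ C : ℝ, 0 < C ∧ ∃ r₁ : ℕ, ∀ r : ℕ, r₁ ≤ r →
    ∫ ω in Level r (M * r) (k - 1), fibre r (M * r) k ω ^ 2 ∂(bondPercolation (zdGraph 3) (criticalProbI 3)) ≤
      C * ∫ ω in Level r (M * r) (k - 1), fibre r (M * r) k ω ∂(bondPercolation (zdGraph 3) (criticalProbI 3))

end Summit.CriticalPhenomena.PercolationContinuityZ3.Theorems.NearLinearTwoClusterDecayKiss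

namespace Summit.CriticalPhenomena.PercolationContinuityZ3.Theorems

open MeasureTheory Filter
open Literature.Probability.LatticeModels Literature.Probability.Percolation

/-- The landed open-shell two-cluster event `Sh(N, R)` (hypothesis event of
`nearLinearTwoClusterDecay_of_fixedAspectShellNonCertainty`) is contained in `{N(N+1, R) ≥ 2}`
(`stub_shellEncoding`, definitional unfolding of `NearLinearTwoClusterDecayKiss.AtLeast`). -/
theorem NearLinearTwoClusterDecayKiss.sh_subset_atLeast_two (N R : ℕ) :
    {ω : BondConfig (Site 3) | ∃ u ∈ (↑(box 3 (N + 1)) : Set (Site 3)) \ ↑(box 3 N),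
        ∃ u' ∈ (↑(box 3 (N + 1)) : Set (Site 3)) \ ↑(box 3 N),
        ∃ v ∈ innerBoundary (zdGraph 3) (box 3 R), ∃ v' ∈ innerBoundary (zdGraph 3) (box 3 R),
          ω ∈ openConnIn ((↑(box 3 R) : Set (Site 3)) \ ↑(box 3 N)) u v ∧
          ω ∈ openConnIn ((↑(box 3 R) : Set (Site 3)) \ ↑(box 3 N)) u' v' ∧
          ω ∉ openConnIn ((↑(box 3 R) : Set (Site 3)) \ ↑(box 3 N)) u u'} ⊆
      NearLinearTwoClusterDecayKiss.AtLeast (N + 1) R 2 :=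
  fun ω h => stub_shellEncoding N R ω h

/-- **`NearLinearTwoClusterDecay` from bounded-aspect non-proliferation in the closed-shell counting vocabulary**
(`GoodAt M 2 = NP_M` at SOME aspect `M ≥ 2`): for `N ≥ max r₀ 1` the open shell `Λ(2MN) ∖ Λ(N)` contains the closed
shell `S(N+1, M(N+1))`, so `P(Sh(N, 2MN)) ≤ P(N(N+1, M(N+1)) ≥ 2) ≤ 1 - c` (`real_shellTwoCluster_antitone`,
`sh_subset_atLeast_two`) — the clean `NP_{2M}` consumed by the landed
`nearLinearTwoClusterDecay_of_fixedAspectShellNonCertainty` (orange-peeling chain). Registered bridge of the crux skeleton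
`Lines/shell_product_kiss_positivity.lean`. -/
theorem nearLinearTwoClusterDecay_of_goodAt
    (h : ∃ M : ℕ, 2 ≤ M ∧ NearLinearTwoClusterDecayKiss.GoodAt M 2) :
    Summit.CriticalPhenomena.PercolationContinuityZ3.Theses.PercShatteringRace.NearLinearTwoClusterDecay := by
  obtain ⟨M, hM, c, hc, r₀, hG⟩ := h
  refine nearLinearTwoClusterDecay_of_fixedAspectShellNonCertainty ⟨2 * M, by omega, c, hc, ?_⟩
  filter_upwards [eventually_ge_atTop (max r₀ 1)] with N hN
  have hN1 : 1 ≤ N := le_trans (le_max_right _ _) hN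
  have hr : r₀ ≤ N + 1 := le_trans (le_max_left _ _) (hN.trans (Nat.le_succ N))
  have h1 : N < M * (N + 1) := by nlinarith
  have h2 : M * (N + 1) ≤ 2 * M * N := by nlinarith
  refine (real_shellTwoCluster_antitone (criticalProbI 3) (le_refl N) h1 h2).trans ?_
  exact (measureReal_mono (NearLinearTwoClusterDecayKiss.sh_subset_atLeast_two N (M * (N + 1)))).trans (hG (N + 1) hr)

/-- **`PercFiniteBoxLRO.CritBoxTwoArmsDecay` (stmt-CriticalPhenomena-0859) from the same hypothesis** (two-cluster decay at
every aspect exponent `α > 1`). -/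
theorem critBoxTwoArmsDecay_of_goodAt
    (h : ∃ M : ℕ, 2 ≤ M ∧ NearLinearTwoClusterDecayKiss.GoodAt M 2) :
    Summit.CriticalPhenomena.PercolationContinuityZ3.Theses.PercFiniteBoxLRO.CritBoxTwoArmsDecay := by
  obtain ⟨M, hM, c, hc, r₀, hG⟩ := h
  refine critBoxTwoArmsDecay_of_fixedAspectShellNonCertainty ⟨2 * M, by omega, c, hc, ?_⟩
  filter_upwards [eventually_ge_atTop (max r₀ 1)] with N hN
  have hN1 : 1 ≤ N := le_trans (le_max_right _ _) hN
  have hr : r₀ ≤ N + 1 := le_trans (le_max_left _ _) (hN.trans (Nat.le_succ N))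
  have h1 : N < M * (N + 1) := by nlinarith
  have h2 : M * (N + 1) ≤ 2 * M * N := by nlinarith
  refine (real_shellTwoCluster_antitone (criticalProbI 3) (le_refl N) h1 h2).trans ?_
  exact (measureReal_mono (NearLinearTwoClusterDecayKiss.sh_subset_atLeast_two N (M * (N + 1)))).trans (hG (N + 1) hr)

end Summit.CriticalPhenomena.PercolationContinuityZ3.Theorems

end
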